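import Literature.Geometry.Kaehler.ComplexTorusTranscendentalLatticeAllDegreesIsogeny
import Literature.Geometry.Kaehler.ComplexTorusSubtorusHodgeClass
import Literature.Geometry.Kaehler.ComplexTorusHodgeClassesDimension
import Literature.Geometry.Kaehler.ComplexTorusSubtorusQuotientCohomology
import HarnessLib

/-!
# The transcendental lattice in every degree is FUNCTORIAL under all homomorphisms of complex tori:
# `f^* T^l_{k′,p′}(X′) ⊆ T^l_{k,p}(X)` for every homomorphism `f = ρ(A) : X → X′` (any dimensions), `rk T(X′) ≤ rk T(X)` for `f` surjective,
# `f^* T = T` for isomorphisms, and `T^l(X)` is stable under `End(X)`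

Layer `Literature/Geometry/Kaehler`, namespace `Literature.Geometry.Kaehler.ComplexTorus`; lane `lit-hodgefound` (Track 2
foundations library), seat p09, generation 33, row g33-#3. THEOREMS ONLY (0 definitions); no named fact, net debt 0. For complex tori
`X = E/Φ(ℤ^ι)` (`|ι| = n = 2g`), `X′ = E′/Φ′(ℤ^{ι′})` (`|ι′| = n′ = 2g′`) and a HOMOMORPHISM `f : X → X′` — an integer matrix `A : ι′ × ι`
(rational representation) whose analytic representation `ρ(A) = realRep Φ Φ′ A : E → E′` is `ℂ`-linear (hypothesis `hA`; Lange §1.2.1) —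
the degree-`l` transcendental lattices of g31-#11 (`ComplexTorusTranscendentalLatticeAllDegrees`; written out as there)

  `T^l_{k,p}(X) = Hˡ(X, ℤ) ∩ ⋂_{s ∈ Hdg^{k,p}(X, ℤ)} ker ⟨s, ·⟩_e`   (`k + l = n`, `p + p = k`),
  `T^l_{k′,p′}(X′) = Hˡ(X′, ℤ) ∩ ⋂_{s′ ∈ Hdg^{k′,p′}(X′, ℤ)} ker ⟨s′, ·⟩_{e′}`   (`k′ + l = n′`, `p′ + p′ = k′`)

satisfy **`f^* T^l_{k′,p′}(X′) ⊆ T^l_{k,p}(X)`** — with NO hypothesis on `f` (not an isogeny, any `g`, `g′`). This generalises g31-#12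
(`IsIsogeny.comp_realRep_mem_integralHodgeAnnihilator`, isogenies) and g33-#1/#2 (projections and fibre inclusions of a product).

PROOF (Voisin §7.3.2, PDF pp. 150–151, made integral-free on the target side): for `S ∈ Hdg^{k,p}(X, ℤ)` the functional
`y ↦ ⟨S, f^*y⟩_X` on `Hˡ(X′, ℚ)` is, by perfect Poincaré duality over `ℚ` on `X′` (the tree's `poincarePairingRat_isPerfPair`), of the form
`⟨S′, ·⟩_{X′}` for a unique RATIONAL class `S′ ∈ H^{k′}(X′, ℚ)` ("`φ_* = PD⁻¹ ∘ ᵗ(φ^*) ∘ PD`", the Gysin image of `S` up to the orientation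
signs); `⟨S′, β⟩ = ⟨S, f^*β⟩` for all `β` (rational classes span, `span_complex_rationalForms_eq_top`), and `S′` is of type `(p′, p′)` by
Voisin's Lemma 7.30 in the tree's form `isOfTypeAt_of_forall_poincarePairing_eq_left`: `⟨S, f^*β⟩ = 0` for `β` of type `(r, s)`, `r ≠ s`,
because `f^*β` has type `(r, s)` (`ρ(A)` is `ℂ`-linear) and `S ∧ f^*β`, of top degree and type `(p + r, p + s) ≠ (g, g)`, vanishes. Hence
`S′ ∈ B^{k′,p′}(X′)` and `⟨S, f^*t′⟩ = ⟨S′, t′⟩ = 0` for `t′ ∈ T(X′)` (`T` kills all RATIONAL Hodge classes, g31-#11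
`poincarePairing_eq_zero_of_mem_hodgeClassesIn_of_mem_integralHodgeAnnihilator`). No integrality of the Gysin map is needed.

* §1 `exists_mem_hodgeClassesIn_forall_poincarePairing_comp_realRep_eq` (the rational Gysin image of an integral Hodge class is a Hodge class,
  characterised by `⟨S′, β⟩_{X′} = ⟨S, f^*β⟩_X`), **`comp_realRep_mem_integralHodgeAnnihilator`** (`f^* T(X′) ⊆ T(X)`), the `ℤ`-linear map.
* §2 SURJECTIVE `f` (Voisin Lemma 7.28: `f^*` injective): `f^*|_T` injective, **`rk T^l_{k′,p′}(X′) ≤ rk T^l_{k,p}(X)`**.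
* §3 ENDOMORPHISMS and AUTOMORPHISMS of `X`: **`u^* T^l_{k,p}(X) ⊆ T^l_{k,p}(X)`** for every `u ∈ End(X)`; for an isomorphism `f` (integer inverse
  `B`, `BA = 1`, `AB = 1`): `x ∈ T(X) ⟺ (f⁻¹)^*x ∈ T(X′)`, `rk T(X) = rk T(X′)` (Huybrechts Ch. 3 §3.2: Hodge isometries act on `T(X)`).

## FAIL-DUP disclosure

g31-#12 `IsIsogeny.comp_realRep_mem_integralHodgeAnnihilator` / `IsIsogeny.finrank_integralHodgeAnnihilator_eq` are the isogeny cases (there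
via `e(f)` and quasi-inverses, here recovered without `IsIsogeny`); consumed BY NAME: `comp_realRep_mem_integralForms/rationalForms`,
`realRep_mul`, `realRep_one`, `poincarePairingRat`, `coe_poincarePairingRat`, `poincarePairingRat_isPerfPair`, `span_complex_rationalForms_eq_top`,
`isOfTypeAt_of_forall_poincarePairing_eq_left`, `eq_zero_of_isOfTypeAt_of_ne_top`, `finrank_add_finrank_eq_card`, `IsOfTypeAt.compContinuousLinearMap`,
`IsOfTypeAt.wedge`, `poincarePairing_eq_zero_of_mem_hodgeClassesIn_of_mem_integralHodgeAnnihilator`, `moduleFinite_integralHodgeAnnihilator`,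
`compContinuousLinearMap_injective_of_surjective` (p-seat `ComplexTorusSubtorusQuotientCohomology`: Lemma 7.28's linear algebra).
The tree's `gysinMap` / `gysinHom` (`ComplexTorusGysinHodgeStructure`, one universe, `[HodgeTensorFacts]`) is not used.

## References

* [cite: VoisinHodgeI2002, §7.3.2 (PDF p. 150: "`φ^*` is a morphism of Hodge structures"; Lemma 7.28; PDF p. 151: `φ_* = PD⁻¹ ∘ ᵗ(φ^*) ∘ PD`,
  "`φ_*` is a morphism of Hodge structures of bidegree `(r, r)`", Lemma 7.30, "`(φ_*α, β)_Y = (α, φ^*β)_X`")]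
* [cite: Lange2023AbelianVarietiesComplex, §1.1.2 (p. 20: analytic and rational representations `ρ_a`, `ρ_r`); §6.2.4 (p. 310); §7.2.2]
* [cite: Huybrechts2016K3, Ch. 3 §2.2 Def. 2.5 (PDF p. 58), §3.2 Cor. 3.4 (PDF p. 64: Hodge isometries of `T(X)`)]
* [cite: ShiodaMitani1974, §3 (3.19)]
-/

noncomputable section

open Module Function
open Literature.Analysis.Complex

namespace Literature.Geometry.Kaehler.ComplexTorus

section Homomorphisms

variable {ι ι' : Type*} [Fintype ι] [Fintype ι'] [DecidableEq ι] [DecidableEq ι']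
  {E E' : Type*} [NormedAddCommGroup E] [NormedSpace ℂ E] [NormedAddCommGroup E'] [NormedSpace ℂ E']
  (Φ : (ι → ℝ) ≃L[ℝ] E) (Φ' : (ι' → ℝ) ≃L[ℝ] E') {n n' k k' l : ℕ} (e : Fin n ≃ ι) (e' : Fin n' ≃ ι') (h : k + l = n)
  (h' : k' + l = n')

/-! ## §1 `f^* T^l_{k′,p′}(X′) ⊆ T^l_{k,p}(X)` for every homomorphism `f : X → X′` -/

/-- **The (rational) Gysin image of an integral Hodge class is a Hodge class**: for a homomorphism `f = ρ(A) : X → X′` with `ℂ`-linear analytic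
representation and `S ∈ Hdg^{k,p}(X, ℤ)` (`p + p = k`, `k + l = 2g`), there is a rational Hodge class `S′ ∈ B^{k′,p′}(X′)` (`k′ + l = 2g′`,
`p′ + p′ = k′`) with `⟨S′, β⟩_{X′} = ⟨S, f^*β⟩_X` for ALL `β ∈ Altˡ(E′)` — `S′ = PD⁻¹(ᵗ(f^*)(PD S))` exists by perfect Poincaré duality over `ℚ`
and is of type `(p′, p′)` by Lemma 7.30 (`⟨S, f^*β⟩ = 0` off type, `f^*` preserving types).
[cite: VoisinHodgeI2002, §7.3.2 (PDF p. 151: `φ_* = PD⁻¹ ∘ ᵗ(φ^*) ∘ PD`, Lemma 7.30, "`φ_*` is a morphism of Hodge structures")] -/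
theorem exists_mem_hodgeClassesIn_forall_poincarePairing_comp_realRep_eq (A : Matrix ι' ι ℤ)
    (hA : ∀ (c : ℂ) (u : E), realRep Φ Φ' A (c • u) = c • realRep Φ Φ' A u) {p p' : ℕ} (hk : p + p = k) (hk' : p' + p' = k')
    {S : E [⋀^Fin k]→L[ℝ] ℂ} (hS : S ∈ integralHodgeClassesIn Φ k p) :
    ∃ S' ∈ hodgeClassesIn Φ' k' p', ∀ β : E' [⋀^Fin l]→L[ℝ] ℂ,
      poincarePairing Φ' e' h' S' β = poincarePairing Φ e h S (β.compContinuousLinearMap (realRep Φ Φ' A)) := by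
  have hSZ : S ∈ integralForms Φ k := ((mem_integralHodgeClassesIn_iff Φ).1 hS).1
  have hSQ : S ∈ rationalForms Φ k := mem_rationalForms_of_mem_integralForms Φ hSZ
  have hSt : IsOfTypeAt p p S := (mem_typeSubmodule_iff_isOfTypeAt hk).1 ((mem_integralHodgeClassesIn_iff Φ).1 hS).2
  -- the functional `y ↦ ⟨S, f^*y⟩` on `Hˡ(X′, ℚ)`, with values in `ℚ`
  let P : rationalForms Φ' l →ₗ[ℚ] rationalForms Φ l :=
    { toFun := fun y ↦ ⟨(y : E' [⋀^Fin l]→L[ℝ] ℂ).compContinuousLinearMap (realRep Φ Φ' A),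
        comp_realRep_mem_rationalForms Φ Φ' A y.2⟩
      map_add' := fun y y' ↦ Subtype.ext (by ext v; rfl)
      map_smul' := fun c y ↦ Subtype.ext (by ext v; rfl) }
  let ψ : rationalForms Φ' l →ₗ[ℚ] ℚ := (poincarePairingRat Φ e h ⟨S, hSQ⟩).comp P
  have hI : LinearMap.IsPerfPair (M := rationalForms Φ' k') (N := rationalForms Φ' l) (poincarePairingRat Φ' e' h') :=
    inferInstance
  obtain ⟨S', hS'⟩ := hI.bijective_left.2 ψ
  -- `⟨S′, y⟩ = ⟨S, f^*y⟩` for rational `y`, hence for all `β`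
  have hrat : ∀ y : rationalForms Φ' l, poincarePairing Φ' e' h' (S' : E' [⋀^Fin k']→L[ℝ] ℂ) y =
      poincarePairing Φ e h S ((y : E' [⋀^Fin l]→L[ℝ] ℂ).compContinuousLinearMap (realRep Φ Φ' A)) := by
    intro y
    have h1 := LinearMap.congr_fun hS' y
    have h2 := congrArg (fun q : ℚ ↦ (q : ℂ)) h1
    simp only [coe_poincarePairingRat] at h2
    rw [h2]
    exact coe_poincarePairingRat Φ e h ⟨S, hSQ⟩ (P y)
  let L₁ : (E' [⋀^Fin l]→L[ℝ] ℂ) →ₗ[ℂ] ℂ := poincarePairing Φ' e' h' (S' : E' [⋀^Fin k']→L[ℝ] ℂ)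
  let L₂ : (E' [⋀^Fin l]→L[ℝ] ℂ) →ₗ[ℂ] ℂ :=
    { toFun := fun β ↦ poincarePairing Φ e h S (β.compContinuousLinearMap (realRep Φ Φ' A))
      map_add' := fun β β' ↦ by
        have hadd : (β + β').compContinuousLinearMap (realRep Φ Φ' A) =
            β.compContinuousLinearMap (realRep Φ Φ' A) + β'.compContinuousLinearMap (realRep Φ Φ' A) := by
          ext v; rfl
        rw [hadd, map_add]
      map_smul' := fun c β ↦ by
        have hsmul : (c • β).compContinuousLinearMap (realRep Φ Φ' A) = c • β.compContinuousLinearMap (realRep Φ Φ' A) := by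
          ext v; rfl
        rw [hsmul, map_smul, RingHom.id_apply] }
  have hL : L₁ = L₂ :=
    LinearMap.ext_on (span_complex_rationalForms_eq_top Φ' l) fun y hy ↦ hrat ⟨y, hy⟩
  have hall : ∀ β : E' [⋀^Fin l]→L[ℝ] ℂ, poincarePairing Φ' e' h' (S' : E' [⋀^Fin k']→L[ℝ] ℂ) β =
      poincarePairing Φ e h S (β.compContinuousLinearMap (realRep Φ Φ' A)) := fun β ↦ LinearMap.congr_fun hL β
  -- `S′` has type `(p′, p′)` (Lemma 7.30)
  have hn : n = Fintype.card ι := by simpa using Fintype.card_congr e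
  have hgg : finrank ℂ E + finrank ℂ E = k + l := by rw [finrank_add_finrank_eq_card Φ]; omega
  haveI := finiteDimensional_real Φ' e'
  haveI : FiniteDimensional ℂ E' := Module.Finite.of_restrictScalars_finite ℝ ℂ E'
  haveI := finiteDimensional_real Φ e
  haveI : FiniteDimensional ℂ E := Module.Finite.of_restrictScalars_finite ℝ ℂ E
  have htype : IsOfTypeAt p' p' (S' : E' [⋀^Fin k']→L[ℝ] ℂ) := by
    refine isOfTypeAt_of_forall_poincarePairing_eq_left Φ' e' h' hk'
      (fun β ↦ poincarePairing Φ e h S (β.compContinuousLinearMap (realRep Φ Φ' A))) (fun β r s hβ hrs ↦ ?_) hall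
    have hβ' : IsOfTypeAt r s (β.compContinuousLinearMap (realRep Φ Φ' A)) := hβ.compContinuousLinearMap _ hA
    have hw : IsOfTypeAt (p + r) (p + s) (S.wedge (β.compContinuousLinearMap (realRep Φ Φ' A))) := hSt.wedge hβ'
    have h0 := eq_zero_of_isOfTypeAt_of_ne_top hw hgg (by omega)
    simp only [poincarePairing_apply, h0, ContinuousAlternatingMap.coe_zero, Pi.zero_apply]
  exact ⟨S', (mem_hodgeClassesIn_iff_isOfTypeAt Φ' hk').2 ⟨S'.2, htype⟩, hall⟩

/-- **`f^* T^l_{k′,p′}(X′) ⊆ T^l_{k,p}(X)` for EVERY homomorphism `f = ρ(A) : X → X′` of complex tori** (`ℂ`-linear analytic representation;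
`k + l = 2g`, `k′ + l = 2g′`, `p + p = k`, `p′ + p′ = k′`): for `t′ ∈ Hˡ(X′, ℤ)` annihilating `Hdg^{k′,p′}(X′, ℤ)`, the class `f^*t′ ∈ Hˡ(X, ℤ)`
annihilates `Hdg^{k,p}(X, ℤ)` — `⟨S, f^*t′⟩_X = ⟨S′, t′⟩_{X′} = 0` with `S′ ∈ B^{k′,p′}(X′)` the rational Gysin image of `S`, `T(X′)` killing all
rational Hodge classes. Pull-backs of morphisms of Hodge structures respect the transcendental lattices; the isogeny case is g31-#12.
[cite: VoisinHodgeI2002, §7.3.2 (PDF pp. 150–151)] [cite: Huybrechts2016K3, Ch. 3 §2.2 Def. 2.5 (PDF p. 58)] [cite: Lange2023AbelianVarietiesComplex, §1.1.2 (p. 20) and §7.2.2] -/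
theorem comp_realRep_mem_integralHodgeAnnihilator (A : Matrix ι' ι ℤ)
    (hA : ∀ (c : ℂ) (u : E), realRep Φ Φ' A (c • u) = c • realRep Φ Φ' A u) {p p' : ℕ} (hk : p + p = k) (hk' : p' + p' = k')
    {t' : E' [⋀^Fin l]→L[ℝ] ℂ}
    (ht' : t' ∈ integralForms Φ' l ⊓ ⨅ s : integralHodgeClassesIn Φ' k' p',
        (LinearMap.ker (poincarePairing Φ' e' h' (s : E' [⋀^Fin k']→L[ℝ] ℂ))).toAddSubgroup) :
    t'.compContinuousLinearMap (realRep Φ Φ' A) ∈ integralForms Φ l ⊓ ⨅ s : integralHodgeClassesIn Φ k p,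
        (LinearMap.ker (poincarePairing Φ e h (s : E [⋀^Fin k]→L[ℝ] ℂ))).toAddSubgroup := by
  have ht'' := (mem_integralHodgeAnnihilator_iff Φ' e' h' p').1 ht'
  rw [mem_integralHodgeAnnihilator_iff]
  refine ⟨comp_realRep_mem_integralForms Φ Φ' A ht''.1, fun S hS ↦ ?_⟩
  obtain ⟨S', hS'B, hS'⟩ := exists_mem_hodgeClassesIn_forall_poincarePairing_comp_realRep_eq Φ Φ' e e' h h' A hA hk hk' hS
  rw [← hS' t']
  exact poincarePairing_eq_zero_of_mem_hodgeClassesIn_of_mem_integralHodgeAnnihilator Φ' e' h' p' ht' hS'B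

/-- **`f^*|_T : T^l_{k′,p′}(X′) → T^l_{k,p}(X)` as a `ℤ`-linear map**, for every homomorphism `f`. [cite: VoisinHodgeI2002, §7.3.2 (PDF pp. 150–151)] -/
theorem exists_intLinearMap_integralHodgeAnnihilator_comp_realRep (A : Matrix ι' ι ℤ)
    (hA : ∀ (c : ℂ) (u : E), realRep Φ Φ' A (c • u) = c • realRep Φ Φ' A u) {p p' : ℕ} (hk : p + p = k) (hk' : p' + p' = k') :
    ∃ R : ↥(integralForms Φ' l ⊓ ⨅ s : integralHodgeClassesIn Φ' k' p',
          (LinearMap.ker (poincarePairing Φ' e' h' (s : E' [⋀^Fin k']→L[ℝ] ℂ))).toAddSubgroup) →ₗ[ℤ]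
        ↥(integralForms Φ l ⊓ ⨅ s : integralHodgeClassesIn Φ k p,
          (LinearMap.ker (poincarePairing Φ e h (s : E [⋀^Fin k]→L[ℝ] ℂ))).toAddSubgroup),
      ∀ t, (R t : E [⋀^Fin l]→L[ℝ] ℂ) = (t : E' [⋀^Fin l]→L[ℝ] ℂ).compContinuousLinearMap (realRep Φ Φ' A) :=
  ⟨(AddMonoidHom.mk' (fun t ↦ ⟨(t : E' [⋀^Fin l]→L[ℝ] ℂ).compContinuousLinearMap (realRep Φ Φ' A),
      comp_realRep_mem_integralHodgeAnnihilator Φ Φ' e e' h h' A hA hk hk' t.2⟩) fun _ _ ↦ Subtype.ext (by ext v; rfl)).toIntLinearMap,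
    fun _ ↦ rfl⟩

/-! ## §2 Surjective homomorphisms: `f^*|_T` is injective, `rk T(X′) ≤ rk T(X)` -/

/-- **`f^*|_T : T^l_{k′,p′}(X′) ↪ T^l_{k,p}(X)` is INJECTIVE for a surjective homomorphism `f`** (Voisin Lemma 7.28: `φ^*` is injective for
`φ` surjective). [cite: VoisinHodgeI2002, §7.3.2 Lemma 7.28 (PDF p. 150)] -/
theorem exists_intLinearMap_integralHodgeAnnihilator_comp_realRep_injective (A : Matrix ι' ι ℤ)
    (hA : ∀ (c : ℂ) (u : E), realRep Φ Φ' A (c • u) = c • realRep Φ Φ' A u) (hsurj : Surjective (realRep Φ Φ' A))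
    {p p' : ℕ} (hk : p + p = k) (hk' : p' + p' = k') :
    ∃ R : ↥(integralForms Φ' l ⊓ ⨅ s : integralHodgeClassesIn Φ' k' p',
          (LinearMap.ker (poincarePairing Φ' e' h' (s : E' [⋀^Fin k']→L[ℝ] ℂ))).toAddSubgroup) →ₗ[ℤ]
        ↥(integralForms Φ l ⊓ ⨅ s : integralHodgeClassesIn Φ k p,
          (LinearMap.ker (poincarePairing Φ e h (s : E [⋀^Fin k]→L[ℝ] ℂ))).toAddSubgroup),
      (∀ t, (R t : E [⋀^Fin l]→L[ℝ] ℂ) = (t : E' [⋀^Fin l]→L[ℝ] ℂ).compContinuousLinearMap (realRep Φ Φ' A)) ∧ Injective R := by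
  obtain ⟨R, hR⟩ := exists_intLinearMap_integralHodgeAnnihilator_comp_realRep Φ Φ' e e' h h' A hA hk hk'
  refine ⟨R, hR, fun t t' htt ↦ Subtype.ext (compContinuousLinearMap_injective_of_surjective (ρ := realRep Φ Φ' A) hsurj ?_)⟩
  have h1 := congrArg (fun z : ↥(integralForms Φ l ⊓ ⨅ s : integralHodgeClassesIn Φ k p,
    (LinearMap.ker (poincarePairing Φ e h (s : E [⋀^Fin k]→L[ℝ] ℂ))).toAddSubgroup) ↦ (z : E [⋀^Fin l]→L[ℝ] ℂ)) htt
  simpa only [hR] using h1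

/-- **`rk_ℤ T^l_{k′,p′}(X′) ≤ rk_ℤ T^l_{k,p}(X)` for a surjective homomorphism `f : X → X′`** (`f^*` embeds the transcendental lattice of the
image torus into that of the source). [cite: VoisinHodgeI2002, §7.3.2 Lemma 7.28 (PDF p. 150)] [cite: Huybrechts2016K3, Ch. 3 §2.3 (PDF p. 59)] -/
theorem finrank_integralHodgeAnnihilator_le_of_surjective (A : Matrix ι' ι ℤ)
    (hA : ∀ (c : ℂ) (u : E), realRep Φ Φ' A (c • u) = c • realRep Φ Φ' A u) (hsurj : Surjective (realRep Φ Φ' A))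
    {p p' : ℕ} (hk : p + p = k) (hk' : p' + p' = k') :
    finrank ℤ ↥(integralForms Φ' l ⊓ ⨅ s : integralHodgeClassesIn Φ' k' p',
        (LinearMap.ker (poincarePairing Φ' e' h' (s : E' [⋀^Fin k']→L[ℝ] ℂ))).toAddSubgroup) ≤
      finrank ℤ ↥(integralForms Φ l ⊓ ⨅ s : integralHodgeClassesIn Φ k p,
        (LinearMap.ker (poincarePairing Φ e h (s : E [⋀^Fin k]→L[ℝ] ℂ))).toAddSubgroup) := by
  obtain ⟨R, -, hR⟩ := exists_intLinearMap_integralHodgeAnnihilator_comp_realRep_injective Φ Φ' e e' h h' A hA hsurj hk hk'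
  haveI := moduleFinite_integralHodgeAnnihilator Φ e h p (k := k) (l := l)
  exact LinearMap.finrank_le_finrank_of_injective hR

/-! ## §3 Endomorphisms and automorphisms: `T^l(X)` is an `End(X)`-stable lattice; `f^* T = T` for isomorphisms -/

omit [Fintype ι'] [DecidableEq ι'] in
/-- **`u^* T^l_{k,p}(X) ⊆ T^l_{k,p}(X)` for every endomorphism `u = ρ(A)` of `X`** (`A : ι × ι` with `ℂ`-linear analytic representation): the
degree-`l` transcendental lattice is stable under the (contravariant) action of `End(X)`.
[cite: VoisinHodgeI2002, §7.3.2 (PDF pp. 150–151)] [cite: Huybrechts2016K3, Ch. 3 §3.2 Cor. 3.4 (PDF p. 64: Hodge isometries of `T(X)`)] -/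
theorem comp_realRep_mem_integralHodgeAnnihilator_of_end (A : Matrix ι ι ℤ)
    (hA : ∀ (c : ℂ) (u : E), realRep Φ Φ A (c • u) = c • realRep Φ Φ A u) {p : ℕ} (hk : p + p = k) {t : E [⋀^Fin l]→L[ℝ] ℂ}
    (ht : t ∈ integralForms Φ l ⊓ ⨅ s : integralHodgeClassesIn Φ k p,
        (LinearMap.ker (poincarePairing Φ e h (s : E [⋀^Fin k]→L[ℝ] ℂ))).toAddSubgroup) :
    t.compContinuousLinearMap (realRep Φ Φ A) ∈ integralForms Φ l ⊓ ⨅ s : integralHodgeClassesIn Φ k p,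
        (LinearMap.ker (poincarePairing Φ e h (s : E [⋀^Fin k]→L[ℝ] ℂ))).toAddSubgroup :=
  comp_realRep_mem_integralHodgeAnnihilator Φ Φ e e h h A hA hk hk ht

/-- The inverse of an isomorphism with `ℂ`-linear analytic representation has `ℂ`-linear analytic representation.
[cite: Lange2023AbelianVarietiesComplex, §1.1.2 (p. 20)] -/
theorem realRep_smul_of_inverse {A : Matrix ι' ι ℤ} {B : Matrix ι ι' ℤ}
    (hA : ∀ (c : ℂ) (u : E), realRep Φ Φ' A (c • u) = c • realRep Φ Φ' A u) (hBA : B * A = 1) (hAB : A * B = 1)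
    (c : ℂ) (w : E') : realRep Φ' Φ B (c • w) = c • realRep Φ' Φ B w := by
  have h1 : ∀ v : E', realRep Φ Φ' A (realRep Φ' Φ B v) = v := fun v ↦ by
    rw [← ContinuousLinearMap.comp_apply, realRep_mul, hAB, realRep_one, ContinuousLinearMap.id_apply]
  have h2 : ∀ u : E, realRep Φ' Φ B (realRep Φ Φ' A u) = u := fun u ↦ by
    rw [← ContinuousLinearMap.comp_apply, realRep_mul, hBA, realRep_one, ContinuousLinearMap.id_apply]
  calc realRep Φ' Φ B (c • w) = realRep Φ' Φ B (c • realRep Φ Φ' A (realRep Φ' Φ B w)) := by rw [h1]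
    _ = realRep Φ' Φ B (realRep Φ Φ' A (c • realRep Φ' Φ B w)) := by rw [hA]
    _ = c • realRep Φ' Φ B w := h2 _

/-- **`f^* T(X′) = T(X)` for an ISOMORPHISM `f = ρ(A) : X ⥲ X′`** (integer inverse `B`): `x ∈ T^l_{k,p}(X) ⟺ (f⁻¹)^*x ∈ T^l_{k′,p′}(X′)`
(both pull-backs respect `T`, and `f^*(f⁻¹)^* = id`). [cite: VoisinHodgeI2002, §7.3.2 (PDF pp. 150–151)] [cite: Huybrechts2016K3, Ch. 3 §3.2 Cor. 3.4 (PDF p. 64)] -/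
theorem comp_realRep_mem_integralHodgeAnnihilator_iff_of_inverse {A : Matrix ι' ι ℤ} {B : Matrix ι ι' ℤ}
    (hA : ∀ (c : ℂ) (u : E), realRep Φ Φ' A (c • u) = c • realRep Φ Φ' A u) (hBA : B * A = 1) (hAB : A * B = 1)
    {p p' : ℕ} (hk : p + p = k) (hk' : p' + p' = k') (x : E [⋀^Fin l]→L[ℝ] ℂ) :
    x.compContinuousLinearMap (realRep Φ' Φ B) ∈ integralForms Φ' l ⊓ ⨅ s : integralHodgeClassesIn Φ' k' p',
          (LinearMap.ker (poincarePairing Φ' e' h' (s : E' [⋀^Fin k']→L[ℝ] ℂ))).toAddSubgroup ↔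
      x ∈ integralForms Φ l ⊓ ⨅ s : integralHodgeClassesIn Φ k p,
        (LinearMap.ker (poincarePairing Φ e h (s : E [⋀^Fin k]→L[ℝ] ℂ))).toAddSubgroup := by
  have hB := realRep_smul_of_inverse Φ Φ' hA hBA hAB
  have hxx : (x.compContinuousLinearMap (realRep Φ' Φ B)).compContinuousLinearMap (realRep Φ Φ' A) = x := by
    have hc : (x.compContinuousLinearMap (realRep Φ' Φ B)).compContinuousLinearMap (realRep Φ Φ' A) =
        x.compContinuousLinearMap ((realRep Φ' Φ B).comp (realRep Φ Φ' A)) := by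
      ext v; rfl
    rw [hc, realRep_mul, hBA, realRep_one]
    ext v; rfl
  refine ⟨fun hx ↦ ?_, fun hx ↦ comp_realRep_mem_integralHodgeAnnihilator Φ' Φ e' e h' h B hB hk' hk hx⟩
  have h2 := comp_realRep_mem_integralHodgeAnnihilator Φ Φ' e e' h h' A hA hk hk' hx
  rwa [hxx] at h2

/-- **`rk_ℤ T^l_{k,p}(X) = rk_ℤ T^l_{k′,p′}(X′)` for isomorphic complex tori** (`f` an isomorphism with `ℂ`-linear analytic representation):
both `f^*` and `(f⁻¹)^*` embed. [cite: VoisinHodgeI2002, §7.3.2 Lemma 7.28] [cite: ShiodaMitani1974, §3 (3.19)] -/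
theorem finrank_integralHodgeAnnihilator_eq_of_inverse {A : Matrix ι' ι ℤ} {B : Matrix ι ι' ℤ}
    (hA : ∀ (c : ℂ) (u : E), realRep Φ Φ' A (c • u) = c • realRep Φ Φ' A u) (hBA : B * A = 1) (hAB : A * B = 1)
    {p p' : ℕ} (hk : p + p = k) (hk' : p' + p' = k') :
    finrank ℤ ↥(integralForms Φ l ⊓ ⨅ s : integralHodgeClassesIn Φ k p,
        (LinearMap.ker (poincarePairing Φ e h (s : E [⋀^Fin k]→L[ℝ] ℂ))).toAddSubgroup) =
      finrank ℤ ↥(integralForms Φ' l ⊓ ⨅ s : integralHodgeClassesIn Φ' k' p',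
        (LinearMap.ker (poincarePairing Φ' e' h' (s : E' [⋀^Fin k']→L[ℝ] ℂ))).toAddSubgroup) := by
  have hB := realRep_smul_of_inverse Φ Φ' hA hBA hAB
  have hsA : Surjective (realRep Φ Φ' A) := fun v ↦ ⟨realRep Φ' Φ B v, by
    rw [← ContinuousLinearMap.comp_apply, realRep_mul, hAB, realRep_one, ContinuousLinearMap.id_apply]⟩
  have hsB : Surjective (realRep Φ' Φ B) := fun u ↦ ⟨realRep Φ Φ' A u, by
    rw [← ContinuousLinearMap.comp_apply, realRep_mul, hBA, realRep_one, ContinuousLinearMap.id_apply]⟩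
  exact le_antisymm (finrank_integralHodgeAnnihilator_le_of_surjective Φ' Φ e' e h' h B hB hsB hk' hk)
    (finrank_integralHodgeAnnihilator_le_of_surjective Φ Φ' e e' h h' A hA hsA hk hk')

end Homomorphisms

end Literature.Geometry.Kaehler.ComplexTorus
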